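import Literature.MathematicalPhysics.QuantumFieldTheory.Balaban1983to89.B16Ineq382VPrime

/-!
# `Balaban1983to89.B15TreeGaugeT0` — T. Bałaban, *Large field renormalization. I. The basic step of the 𝐑 operation*, Commun. Math. Phys. **122** (1989) 175–202 [Balaban1989LargeFieldI], pp. 195–196: the tree `T₀` on the whole of `𝐁₀` — the chain of nested rectangular parallelepipeds `Λ = P⁰ ⊃ P¹ ⊃ ⋯ ⊃ Pᵐ`, the trees of the consecutive annuli joined by the printed external bonds, the `T₀`-paths as lattice WORDS and the gauge transformation `v(x) = V(T₀-path to x)` (single-scale model; PART 4 of this unit's transport reading of the p. 196 gauge)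

statement-level skeleton of published theorems with citation tags; proofs where landed; nothing here is a claim about the Yang–Mills mass gap

PDF held: `paper:balaban1989-cmp122-large-field-i` (journal page = PDF page + 174; pp. 195–196 = PDF pp. 21–22, text layer
re-read for this file; renders `run/shared/lean/pub/pub-balaban/b2b-balaban-ref1/pages/1989-cmp122-large-field-I/…-p021-x2.png`,
`…-p022-x2.png` read by the gen-2 seat of this unit).

WHAT IS REPRODUCED (mega-formalization `lit-balaban`, HOME `run/shared/lean/pub/lit-balaban/`, Phase-2 seat p26, generation 5;
SKELETON rows **B15.Def@196** (the tree gauge `T₀`, r12) and **B15.Claim@196** (*"We can prove that it satisfies |V′ − 1| <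
O(1)M²NR_k⁴ε_k on 𝐁₀"*, served by PART 6 `B15Claim196T0`); referee ref-5).  P. 195, verbatim: *"the domains Λ ⊃ Z″_k ⊃ ⋯ ⊃
Z″_{h+1} ⊃ (Ω″^{~2}_{h+1})^c are rectangular parallelepipeds. … Consider two successive rectangular parallelepipeds in the
sequence, for example P₁ ⊃ P₂"*.  P. 196, verbatim: *"We fix the initial point y = (a₁ + 1/2, …, a_d + 1/2), and a number a ∈
(a′₁, b′₁). … The union of all the contours is a tree graph T on P₁∖P₂ … We fix the gauge putting the bond variables equal to 1
for bonds belonging to the tree graph. We use all gauge degrees of freedom connected with points of P₁∖P₂, except one, so we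
add an external bond to the graph. … For the remaining domains P₂ we choose the bond [(a′₁ − 1/2, a′₂ + 1/2, …, a′_d + 1/2),
(a′₁ + 1/2, a′₂ + 1/2, …, a′_d + 1/2)], and add it to the graph. For P₁ = Λ we add also the additional bond [(y₁ − 1, y₂, …,
y_d), y]. The union of the above described tree graphs and bonds is denoted by T₀. It is a tree graph in 𝐁₀, fixing
completely a gauge in this set."*

THE TYPING (extends PARTS 1–3 `B15TreeGauge196Walks` / `B15TreeGauge196` / `B15TreeGauge196Annulus` of this unit; the GRAPH
reading of the same object is r12's `B15TreeGraph196` §8 `Chain`/`T0`, whose single-scale model this file follows).  §1 the CHAIN: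
corner sites `lo i ≤ hi i` of `Pⁱ = box (lo i) (hi i) ⊂ ℤ^{n+3}`, `i ≤ m`, each consecutive pair with the p. 196 geometry `Geom` of
PART 3 for ONE common threshold `τ` (`ChainGeom`); the layers `layer lo hi i = Pⁱ ∖ Pⁱ⁺¹` and their union `B0 lo hi m` (= the
sites of `𝐁₀`; `mem_B0_iff`: `= P⁰ ∖ Pᵐ`); nesting (`ChainGeom.box_subset`, `lo_lt_of_lt`, `hi_lt_of_lt`), the MERGED pairs
`(Pⁱ, Pⁱ⁺²)` are again `Geom` with annulus `layer i ∪ layer (i+1)` (`geom_merge`, `layer_subset_ann_merge`), and a unit bond of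
`𝐁₀` joins equal or adjacent layers only (`ChainGeom.level_le_succ`).  §2 the `T₀`-PATHS as words from the corner `y⁰ = lo 0`
of `Λ`: `chainWord lo i` (to the corner `yⁱ = lo i`) and `t0word lo hi τ i x = chainWord lo i ++ Γ^i_{yⁱ,x}`; the word identity
`contour_extBond`: `Γ^i_{yⁱ, yⁱ⁺¹ − e₁} ∪ [yⁱ⁺¹ − e₁, yⁱ⁺¹] = treeWord (yⁱ⁺¹ − yⁱ)` — the `T₀`-path enters `Pⁱ⁺¹` through exactly
the printed external bond `[(a′₁ − 1/2, a′₂ + 1/2, …), (a′₁ + 1/2, a′₂ + 1/2, …)]` (`chainWord_succ_eq`).  §3 the level of a site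
(`lvl`, `ChainGeom.lvl_eq`) and the GAUGE TRANSFORMATION `t0GaugeFn V lo hi τ x = V(T₀-path to x)` ([Balaban1989LargeFieldII]
p. 381 *"v(x) = V₀(Γ_{y,x})"* for the whole tree), with `t0GaugeFn_eq_mul`: on `layer i` it is `V(chainWord i) · v_i(x)`, `v_i` =
PART 2's single-annulus `treeGaugeFn`.  §4 the GAUGE CONDITIONS of `V′` on `T₀` (`T0Gauge`: PART 3's `BondsOneAlong` along every
`Γ^i_{yⁱ,x}` and `V′ = 1` on the external bonds) and their consequences `bondsOneAlong_t0word`, `t0GaugeFn_mulCfg` (`V″(T₀-path) =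
V₀(T₀-path)` for `V″ = V′V₀`, (1.81)).  §5 `PlaqSmallOn.mono`.

HONEST SCOPE / DEVIATIONS.  (1) SINGLE-SCALE MODEL: all layers on ONE unit lattice `ℤ^{n+3}` (print: consecutive layers live on
lattices of different scales, *"they are L-bonds for the unit scale in P₁"*), exactly as r12's `B15TreeGraph196` §8; the external
bond of every inner domain is the printed one, the additional `Λ`-bond `[(y₁ − 1, …), y]` only shifts every `T₀`-path by one bond
and is omitted from the words (it changes `v` by a constant left factor, irrelevant for `V^v`).  (2) ONE threshold `a` (`τ`) for
all pairs — allowed by the print's free choice `a ∈ (a′₁, b′₁)` (any value in the innermost interval serves every pair) and used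
for the nesting of the contour systems across levels.  (3) Inner boxes nonempty (`lo i ≤ hi i`) and strictly nested in every
direction (`Geom`, the layers of `M`-cubes of p. 179).  Every declaration is a definition with a body or a proved lemma of lattice
combinatorics; no measure, no claim of [IV]/[V] is asserted.  Unit `lit-balaban-p26` (literature-prover-lit-balaban-p26-g5-0).
-/

noncomputable section

open scoped BigOperators

namespace Literature.MathematicalPhysics.QuantumFieldTheory.Balaban1983to89.B15TreeGauge196

open B7Prop1Explicit B8Lemma1NonAbelian B16Ineq382

variable {n : ℕ}

/-! ## §1 The chain `Λ = P⁰ ⊃ P¹ ⊃ ⋯ ⊃ Pᵐ` of rectangular parallelepipeds (p. 195) -/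

section Chain

/-- **The chain of p. 195** *"Λ ⊃ Z″_k ⊃ ⋯ ⊃ Z″_{h+1} ⊃ (Ω″^{~2}_{h+1})^c are rectangular parallelepipeds"*, single-scale
model: boxes `Pⁱ = [lo i, hi i] ⊂ ℤ^{n+3}`, `i ≤ m`, nonempty, every consecutive pair with the p. 196 geometry of PART 3
(`Geom`: `Pⁱ⁺¹` strictly inside `Pⁱ`, threshold `a ∈ (a′₁, b′₁)`), one common threshold `τ`. [cite: Balaban1989LargeFieldI, p.196] -/
structure ChainGeom (lo hi : ℕ → Site (n + 3)) (τ : ℤ) (m : ℕ) : Prop where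
  geom : ∀ i, i < m → Geom (lo i) (hi i) (lo (i + 1)) (hi (i + 1)) τ
  lo_le_hi : ∀ i, i ≤ m → lo i ≤ hi i

/-- The `i`-th layer `Pⁱ ∖ Pⁱ⁺¹` (the annulus `P₁ ∖ P₂` of the `i`-th consecutive pair). [cite: Balaban1989LargeFieldI, p.196] -/
def layer (lo hi : ℕ → Site (n + 3)) (i : ℕ) : Set (Site (n + 3)) :=
  ann (lo i) (hi i) (lo (i + 1)) (hi (i + 1))

/-- The sites of `𝐁₀` carrying the gauge: the union of the layers `Pⁱ ∖ Pⁱ⁺¹`, `i < m` (p. 196: no gauge is fixed in the last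
domain). [cite: Balaban1989LargeFieldI, p.196] -/
def B0 (lo hi : ℕ → Site (n + 3)) (m : ℕ) : Set (Site (n + 3)) := {z | ∃ i, i < m ∧ z ∈ layer lo hi i}

variable {lo hi : ℕ → Site (n + 3)} {τ : ℤ} {m : ℕ}

/-- `layer_subset_B0` — bookkeeping. [cite: Balaban1989LargeFieldI, p.196] -/
theorem layer_subset_B0 {i : ℕ} (him : i < m) : layer lo hi i ⊆ B0 lo hi m := fun _ hz => ⟨i, him, hz⟩

/-- A chain restricts to its first `k` pairs. [cite: Balaban1989LargeFieldI, p.196] -/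
theorem ChainGeom.mono (hC : ChainGeom lo hi τ m) {k : ℕ} (hk : k ≤ m) : ChainGeom lo hi τ k :=
  ⟨fun i hlt => hC.geom i (lt_of_lt_of_le hlt hk), fun i hle => hC.lo_le_hi i (hle.trans hk)⟩

/-- Strict nesting of the lower corners: `lo i < lo j` coordinatewise for `i < j ≤ m`. [cite: Balaban1989LargeFieldI, p.196] -/
theorem ChainGeom.lo_lt_of_lt (hC : ChainGeom lo hi τ m) {i j : ℕ} (hij : i < j) (hj : j ≤ m) (κ : Fin (n + 3)) :
    lo i κ < lo j κ := by
  induction j with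
  | zero => exact absurd hij (Nat.not_lt_zero _)
  | succ j ih =>
    have h1 := (hC.geom j (by omega)).lo_lt κ
    rcases Nat.lt_succ_iff.mp hij |>.eq_or_lt with rfl | hlt
    · exact h1
    · exact (ih hlt (by omega)).trans h1

/-- Strict nesting of the upper corners: `hi j < hi i` coordinatewise for `i < j ≤ m`. [cite: Balaban1989LargeFieldI, p.196] -/
theorem ChainGeom.hi_lt_of_lt (hC : ChainGeom lo hi τ m) {i j : ℕ} (hij : i < j) (hj : j ≤ m) (κ : Fin (n + 3)) :
    hi j κ < hi i κ := by
  induction j with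
  | zero => exact absurd hij (Nat.not_lt_zero _)
  | succ j ih =>
    have h1 := (hC.geom j (by omega)).lt_hi κ
    rcases Nat.lt_succ_iff.mp hij |>.eq_or_lt with rfl | hlt
    · exact h1
    · exact h1.trans (ih hlt (by omega))

/-- `lo i ≤ lo j` for `i ≤ j ≤ m`. [cite: Balaban1989LargeFieldI, p.196] -/
theorem ChainGeom.lo_le_of_le (hC : ChainGeom lo hi τ m) {i j : ℕ} (hij : i ≤ j) (hj : j ≤ m) : lo i ≤ lo j := by
  rcases hij.eq_or_lt with rfl | hlt
  · exact le_rfl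
  · exact fun κ => (hC.lo_lt_of_lt hlt hj κ).le

/-- `hi j ≤ hi i` for `i ≤ j ≤ m`. [cite: Balaban1989LargeFieldI, p.196] -/
theorem ChainGeom.hi_le_of_le (hC : ChainGeom lo hi τ m) {i j : ℕ} (hij : i ≤ j) (hj : j ≤ m) : hi j ≤ hi i := by
  rcases hij.eq_or_lt with rfl | hlt
  · exact le_rfl
  · exact fun κ => (hC.hi_lt_of_lt hlt hj κ).le

/-- **Nested boxes**: `Pʲ ⊆ Pⁱ` for `i ≤ j ≤ m`. [cite: Balaban1989LargeFieldI, p.196] -/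
theorem ChainGeom.box_subset (hC : ChainGeom lo hi τ m) {i j : ℕ} (hij : i ≤ j) (hj : j ≤ m) :
    box (lo j) (hi j) ⊆ box (lo i) (hi i) := fun _ hz =>
  mem_box_iff.mpr fun κ => ⟨(hC.lo_le_of_le hij hj κ).trans (mem_box_iff.mp hz κ).1,
    (mem_box_iff.mp hz κ).2.trans (hC.hi_le_of_le hij hj κ)⟩

/-- The layers lie in `Λ = P⁰`. [cite: Balaban1989LargeFieldI, p.196] -/
theorem ChainGeom.layer_subset_box (hC : ChainGeom lo hi τ m) {i : ℕ} (him : i < m) :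
    layer lo hi i ⊆ box (lo 0) (hi 0) := fun _ hz => hC.box_subset (Nat.zero_le i) him.le hz.1

/-- The layers miss the last domain `Pᵐ`. [cite: Balaban1989LargeFieldI, p.196] -/
theorem ChainGeom.not_mem_box_last (hC : ChainGeom lo hi τ m) {i : ℕ} (him : i < m) {z : Site (n + 3)}
    (hz : z ∈ layer lo hi i) : z ∉ box (lo m) (hi m) := fun h => hz.2 (hC.box_subset (i := i + 1) him le_rfl h)

/-- The sides of every box of the chain are at most those of `Λ`: `hi i − lo i ≤ hi 0 − lo 0 ≤ W`. [cite: Balaban1989LargeFieldI, p.177] -/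
theorem ChainGeom.width_le (hC : ChainGeom lo hi τ m) {W : ℕ} (hW : ∀ κ, hi 0 κ - lo 0 κ ≤ W) {i : ℕ} (him : i ≤ m)
    (κ : Fin (n + 3)) : hi i κ - lo i κ ≤ W := by
  have h1 : lo 0 κ ≤ lo i κ := hC.lo_le_of_le (Nat.zero_le i) him κ
  have h2 : hi i κ ≤ hi 0 κ := hC.hi_le_of_le (Nat.zero_le i) him κ
  have h3 := hW κ
  omega

/-- **The merged pair `(Pⁱ, Pⁱ⁺²)` has the p. 196 geometry** with the same threshold (the threshold condition is that of the
pair `(Pⁱ⁺¹, Pⁱ⁺²)`; strict nesting is transitive). [cite: Balaban1989LargeFieldI, p.196] -/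
theorem ChainGeom.geom_merge (hC : ChainGeom lo hi τ m) {i : ℕ} (him : i + 1 < m) :
    Geom (lo i) (hi i) (lo (i + 2)) (hi (i + 2)) τ where
  lo_lt κ := ((hC.geom i (by omega)).lo_lt κ).trans ((hC.geom (i + 1) him).lo_lt κ)
  lt_hi κ := ((hC.geom (i + 1) him).lt_hi κ).trans ((hC.geom i (by omega)).lt_hi κ)
  le_tau := (hC.geom (i + 1) him).le_tau
  tau_le := (hC.geom (i + 1) him).tau_le

/-- The annulus of the merged pair is the union of the two layers: `layer i ⊆ Pⁱ ∖ Pⁱ⁺²`. [cite: Balaban1989LargeFieldI, p.196] -/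
theorem ChainGeom.layer_subset_ann_merge (hC : ChainGeom lo hi τ m) {i : ℕ} (him : i + 1 < m) :
    layer lo hi i ⊆ ann (lo i) (hi i) (lo (i + 2)) (hi (i + 2)) := fun _ hz =>
  ⟨hz.1, fun h => hz.2 (hC.box_subset (i := i + 1) (j := i + 2) (by omega) (by omega) h)⟩

/-- … and `layer (i+1) ⊆ Pⁱ ∖ Pⁱ⁺²`. [cite: Balaban1989LargeFieldI, p.196] -/
theorem ChainGeom.layer_succ_subset_ann_merge (hC : ChainGeom lo hi τ m) {i : ℕ} (him : i + 1 < m) :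
    layer lo hi (i + 1) ⊆ ann (lo i) (hi i) (lo (i + 2)) (hi (i + 2)) := fun _ hz =>
  ⟨hC.box_subset (i := i) (j := i + 1) (by omega) (by omega) hz.1, hz.2⟩

/-- The merged annulus lies in `𝐁₀`. [cite: Balaban1989LargeFieldI, p.196] -/
theorem ann_merge_subset_B0 {i : ℕ} (him : i + 1 < m) :
    ann (lo i) (hi i) (lo (i + 2)) (hi (i + 2)) ⊆ B0 lo hi m := by
  intro z hz
  by_cases h : z ∈ box (lo (i + 1)) (hi (i + 1))
  · exact ⟨i + 1, him, h, hz.2⟩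
  · exact ⟨i, by omega, hz.1, h⟩

/-- A site outside a box `[lo′, hi′]` has a coordinate below `lo′` or above `hi′`. [cite: Balaban1989LargeFieldI, p.195] -/
theorem exists_coord_of_not_mem_box {lo' hi' z : Site (n + 3)} (hz : z ∉ box lo' hi') :
    ∃ κ, z κ < lo' κ ∨ hi' κ < z κ := by
  by_contra h
  simp only [not_exists, not_or, not_lt] at h
  exact hz (mem_box_iff.mpr fun κ => ⟨(h κ).1, (h κ).2⟩)

/-- **A unit bond of `𝐁₀` joins equal or adjacent layers**: if `x ∈ Pⁱ ∖ Pⁱ⁺¹` and `x′ ∈ Pʲ ∖ Pʲ⁺¹` differ by at most `1` in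
every coordinate then `j ≤ i + 1` (the layers of the chain are separated by the margins of `Geom`). [cite: Balaban1989LargeFieldI, p.196] -/
theorem ChainGeom.level_le_succ (hC : ChainGeom lo hi τ m) {i j : ℕ} (_him : i < m) (hj : j < m) {x x' : Site (n + 3)}
    (hx : x ∈ layer lo hi i) (hx' : x' ∈ layer lo hi j) (hclose : ∀ κ, x κ - 1 ≤ x' κ ∧ x' κ ≤ x κ + 1) : j ≤ i + 1 := by
  by_contra hlt
  have hij : i + 2 ≤ j := by omega
  have hx'b := mem_box_iff.mp (hC.box_subset hij hj.le hx'.1)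
  obtain ⟨κ, hκ⟩ := exists_coord_of_not_mem_box hx.2
  have h1 : lo (i + 1) κ < lo (i + 2) κ := (hC.geom (i + 1) (by omega)).lo_lt κ
  have h2 : hi (i + 2) κ < hi (i + 1) κ := (hC.geom (i + 1) (by omega)).lt_hi κ
  have h3 : lo (i + 2) κ ≤ x' κ ∧ x' κ ≤ hi (i + 2) κ := hx'b κ
  have h4 := hclose κ
  omega

/-- The lower corner `yⁱ = lo i` of `Pⁱ` (the root of the `i`-th tree) lies in the layer `Pⁱ ∖ Pⁱ⁺¹`. [cite: Balaban1989LargeFieldI, p.196] -/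
theorem ChainGeom.lo_mem_layer (hC : ChainGeom lo hi τ m) {i : ℕ} (him : i < m) : lo i ∈ layer lo hi i :=
  ⟨mem_box_iff.mpr fun κ => ⟨le_rfl, hC.lo_le_hi i him.le κ⟩, not_mem_box_of_lt i0 ((hC.geom i him).lo_lt i0)⟩

/-- The outer end `yⁱ⁺¹ − e₁` of the external bond of `Pⁱ⁺¹` lies in the layer `Pⁱ ∖ Pⁱ⁺¹`. [cite: Balaban1989LargeFieldI, p.196] -/
theorem ChainGeom.extEnd_mem_layer (hC : ChainGeom lo hi τ m) {i : ℕ} (him : i + 1 ≤ m) :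
    lo (i + 1) - e i0 ∈ layer lo hi i := by
  have hG := hC.geom i him
  refine ⟨mem_box_iff.mpr fun κ => ?_, not_mem_box_of_lt i0 (by simp [e_apply_self])⟩
  have h1 : lo i κ < lo (i + 1) κ := hG.lo_lt κ
  have h2 : hi (i + 1) κ < hi i κ := hG.lt_hi κ
  have h3 : lo (i + 1) κ ≤ hi (i + 1) κ := hC.lo_le_hi (i + 1) him κ
  simp only [Pi.sub_apply, e_apply]
  split_ifs <;> constructor <;> omega

end Chain

/-! ## §2 The `T₀`-paths as lattice words from the corner `y⁰` of `Λ` -/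

section Words

variable {lo hi : ℕ → Site (n + 3)} {τ : ℤ} {m : ℕ}

/-- The `T₀`-path from the corner `y⁰ = lo 0` of `Λ` to the corner `yⁱ = lo i` of `Pⁱ`: through the trees of the layers
`0, …, i−1` and the external bonds — spelled as the chain of the usual contours `treeWord (yʲ⁺¹ − yʲ)` (see `contour_extBond`:
each is `Γ^j_{yʲ, yʲ⁺¹ − e₁}` followed by the external bond of `Pʲ⁺¹`). [cite: Balaban1989LargeFieldI, p.196] -/
def chainWord (lo : ℕ → Site (n + 3)) : ℕ → List (Letter (n + 3))
  | 0 => []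
  | i + 1 => chainWord lo i ++ treeWord (lo (i + 1) - lo i)

/-- The `T₀`-path from `y⁰` to a site `x` of the `i`-th layer: to the corner `yⁱ`, then the contour `Γ^i_{yⁱ,x}` of p. 196.
[cite: Balaban1989LargeFieldI, p.196] -/
def t0word (lo hi : ℕ → Site (n + 3)) (τ : ℤ) (i : ℕ) (x : Site (n + 3)) : List (Letter (n + 3)) :=
  chainWord lo i ++ contour (lo i) (hi i) τ x

/-- `chainWord_zero` — bookkeeping. [cite: Balaban1989LargeFieldI, p.196] -/
@[simp] theorem chainWord_zero : chainWord lo 0 = [] := rfl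

/-- `chainWord_succ` — bookkeeping. [cite: Balaban1989LargeFieldI, p.196] -/
theorem chainWord_succ (i : ℕ) : chainWord lo (i + 1) = chainWord lo i ++ treeWord (lo (i + 1) - lo i) := rfl

/-- The chain word ends at the corner `yⁱ`. [cite: Balaban1989LargeFieldI, p.196] -/
theorem disp_chainWord : ∀ i : ℕ, disp (chainWord lo i) = lo i - lo 0
  | 0 => by simp
  | i + 1 => by rw [chainWord_succ, disp_append, disp_chainWord i, disp_treeWord]; abel

/-- `lo 0 + disp (chainWord i) = lo i`. [cite: Balaban1989LargeFieldI, p.196] -/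
theorem add_disp_chainWord (i : ℕ) : lo 0 + disp (chainWord lo i) = lo i := by
  rw [disp_chainWord]; abel

/-- The `T₀`-path to `x` ends at `x`. [cite: Balaban1989LargeFieldI, p.196] -/
theorem disp_t0word (i : ℕ) (x : Site (n + 3)) : disp (t0word lo hi τ i x) = x - lo 0 := by
  rw [t0word, disp_append, disp_chainWord, disp_contour]; abel

/-- One more forward step at the end of a usual contour: `treeWord (v + e₁) = treeWord v ∪ [+e₁]` for `v₁ ≥ 0`.
[cite: Balaban1989LargeFieldI, p.196] -/
theorem treeWord_add_e0 {v : Site (n + 3)} (hv : 0 ≤ v i0) : treeWord (v + e i0) = treeWord v ++ [(i0, true)] := by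
  have hK : (List.finRange (n + 3)).reverse = (highDirs n ++ [i1]) ++ i0 :: [] := by
    rw [finRange_reverse_eq, List.append_assoc]; rfl
  rw [treeWord_eq_tw, treeWord_eq_tw, tw_split_add_e hK finRange_reverse_nodup, tw_split hK, tw_nil,
    List.append_nil, List.append_nil, seg_add_one_of_nonneg i0 hv, List.append_assoc]

/-- **The external bond in the `T₀`-path.**  For a consecutive pair `(P₁, P₂) = (Pⁱ, Pⁱ⁺¹)`: the contour `Γ_{y, y′ − e₁}` to
the outer end of the external bond of `P₂`, followed by that bond `[(a′₁ − 1/2, a′₂ + 1/2, …), (a′₁ + 1/2, a′₂ + 1/2, …)] =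
⟨y′ − e₁, y′⟩`, IS the usual contour `treeWord (y′ − y)` from `y` to the corner `y′` of `P₂`. [cite: Balaban1989LargeFieldI, p.196] -/
theorem contour_extBond {lo₁ hi₁ lo₂ hi₂ : Site (n + 3)} (hG : Geom lo₁ hi₁ lo₂ hi₂ τ) :
    contour lo₁ hi₁ τ (lo₂ - e i0) ++ [(i0, true)] = treeWord (lo₂ - lo₁) := by
  have hle : (lo₂ - e i0 : Site (n + 3)) i0 ≤ τ := by
    have := hG.le_tau; simp [e_apply_self]; omega
  have hv : 0 ≤ (lo₂ - e i0 - lo₁ : Site (n + 3)) i0 := by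
    have := hG.lo_lt i0; simp [e_apply_self]; omega
  rw [contour_of_le hle, ← treeWord_add_e0 hv, show lo₂ - e i0 - lo₁ + e i0 = lo₂ - lo₁ by abel]

/-- The chain word passes through the printed external bonds: `chainWord (i+1) = chainWord i ∪ Γ^i_{yⁱ, yⁱ⁺¹ − e₁} ∪
⟨yⁱ⁺¹ − e₁, yⁱ⁺¹⟩`. [cite: Balaban1989LargeFieldI, p.196] -/
theorem chainWord_succ_eq (hC : ChainGeom lo hi τ m) {i : ℕ} (him : i < m) :
    chainWord lo (i + 1) = chainWord lo i ++ (contour (lo i) (hi i) τ (lo (i + 1) - e i0) ++ [(i0, true)]) := by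
  rw [chainWord_succ, contour_extBond (hC.geom i him)]

end Words

/-! ## §3 The level of a site and the gauge transformation `v(x) = V(T₀-path to x)` -/

section Gauge

variable {lo hi : ℕ → Site (n + 3)} {τ : ℤ} {m : ℕ}

open Classical in
/-- The level of a site: the least `i` with `x ∉ Pⁱ⁺¹` (`= i` on the layer `Pⁱ ∖ Pⁱ⁺¹`; junk elsewhere). [cite: Balaban1989LargeFieldI, p.196] -/
def lvl (lo hi : ℕ → Site (n + 3)) (x : Site (n + 3)) : ℕ :=
  if h : ∃ i : ℕ, x ∉ box (lo (i + 1)) (hi (i + 1)) then Nat.find h else 0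

open Classical in
/-- **The level of a site of the `i`-th layer is `i`.** [cite: Balaban1989LargeFieldI, p.196] -/
theorem ChainGeom.lvl_eq (hC : ChainGeom lo hi τ m) {i : ℕ} (him : i < m) {x : Site (n + 3)} (hx : x ∈ layer lo hi i) :
    lvl lo hi x = i := by
  have h : ∃ j : ℕ, x ∉ box (lo (j + 1)) (hi (j + 1)) := ⟨i, hx.2⟩
  rw [lvl, dif_pos h, Nat.find_eq_iff]
  exact ⟨hx.2, fun j hj hn => hn (hC.box_subset (i := j + 1) (j := i) (by omega) him.le hx.1)⟩

open Classical in
/-- **`𝐁₀ = Λ ∖ Pᵐ`**: a site of `Λ` outside the last domain lies in the layer of its level. [cite: Balaban1989LargeFieldI, p.196] -/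
theorem ChainGeom.mem_layer_lvl (hC : ChainGeom lo hi τ m) {x : Site (n + 3)} (hx0 : x ∈ box (lo 0) (hi 0))
    (hxm : x ∉ box (lo m) (hi m)) : lvl lo hi x < m ∧ x ∈ layer lo hi (lvl lo hi x) := by
  have hm : m ≠ 0 := by rintro rfl; exact hxm hx0
  obtain ⟨k, rfl⟩ : ∃ k, m = k + 1 := ⟨m - 1, by omega⟩
  have h : ∃ j : ℕ, x ∉ box (lo (j + 1)) (hi (j + 1)) := ⟨k, hxm⟩
  rw [lvl, dif_pos h]
  have hle : Nat.find h ≤ k := Nat.find_le hxm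
  refine ⟨by omega, ?_, Nat.find_spec h⟩
  rcases Nat.eq_zero_or_pos (Nat.find h) with h0 | hpos
  · rw [h0]; exact hx0
  · obtain ⟨j, hj⟩ : ∃ j, Nat.find h = j + 1 := ⟨Nat.find h - 1, by omega⟩
    have hmin := Nat.find_min h (show j < Nat.find h by omega)
    rw [hj]
    exact not_not.mp hmin

/-- `mem_B0_iff`: the sites of `𝐁₀` are exactly those of `Λ ∖ Pᵐ`. [cite: Balaban1989LargeFieldI, p.196] -/
theorem ChainGeom.mem_B0_iff (hC : ChainGeom lo hi τ m) {x : Site (n + 3)} :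
    x ∈ B0 lo hi m ↔ x ∈ box (lo 0) (hi 0) ∧ x ∉ box (lo m) (hi m) := by
  constructor
  · rintro ⟨i, him, hx⟩
    exact ⟨hC.layer_subset_box him hx, hC.not_mem_box_last him hx⟩
  · rintro ⟨h0, hm⟩
    obtain ⟨h1, h2⟩ := hC.mem_layer_lvl h0 hm
    exact ⟨_, h1, h2⟩

variable {G : Type*} [Group G]

/-- **The gauge transformation of the tree `T₀`** ([Balaban1989LargeFieldII] p. 381 *"v(x) = V₀(Γ_{y,x})"*, here along the
whole `T₀`-path): `v(x) = V(T₀-path from y⁰ to x)`. [cite: Balaban1989LargeFieldI, p.196] -/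
def t0GaugeFn (V : Site (n + 3) → Fin (n + 3) → G) (lo hi : ℕ → Site (n + 3)) (τ : ℤ) (x : Site (n + 3)) : G :=
  hol V (lo 0) (t0word lo hi τ (lvl lo hi x) x)

/-- On the `i`-th layer the gauge function is the transport along `t0word i x`. [cite: Balaban1989LargeFieldI, p.196] -/
theorem ChainGeom.t0GaugeFn_eq (hC : ChainGeom lo hi τ m) (V : Site (n + 3) → Fin (n + 3) → G) {i : ℕ} (him : i < m)
    {x : Site (n + 3)} (hx : x ∈ layer lo hi i) : t0GaugeFn V lo hi τ x = hol V (lo 0) (t0word lo hi τ i x) := by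
  rw [t0GaugeFn, hC.lvl_eq him hx]

/-- The transport along the `T₀`-path splits at the corner `yⁱ`: `V(t0word i x) = V(chainWord i) · V(Γ^i_{yⁱ,x})` — the second
factor is PART 2's single-annulus gauge function `treeGaugeFn V (lo i) (hi i) τ x`. [cite: Balaban1989LargeFieldI, p.196] -/
theorem hol_t0word (V : Site (n + 3) → Fin (n + 3) → G) (i : ℕ) (x : Site (n + 3)) :
    hol V (lo 0) (t0word lo hi τ i x) = hol V (lo 0) (chainWord lo i) * treeGaugeFn V (lo i) (hi i) τ x := by
  rw [t0word, hol_append, add_disp_chainWord, treeGaugeFn]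

/-- `V(chainWord (i+1)) = V(chainWord i) · V(treeWord (yⁱ⁺¹ − yⁱ))` from `yⁱ`. [cite: Balaban1989LargeFieldI, p.196] -/
theorem hol_chainWord_succ (V : Site (n + 3) → Fin (n + 3) → G) (i : ℕ) :
    hol V (lo 0) (chainWord lo (i + 1)) = hol V (lo 0) (chainWord lo i) * hol V (lo i) (treeWord (lo (i + 1) - lo i)) := by
  rw [chainWord_succ, hol_append, add_disp_chainWord]

/-- **On the `i`-th layer `v = gᵢ · vᵢ`**: the `T₀` gauge function is the single-annulus gauge function of the pair
`(Pⁱ, Pⁱ⁺¹)` multiplied on the left by the constant `gᵢ = V(chainWord i)`. [cite: Balaban1989LargeFieldI, p.196] -/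
theorem ChainGeom.t0GaugeFn_eq_mul (hC : ChainGeom lo hi τ m) (V : Site (n + 3) → Fin (n + 3) → G) {i : ℕ}
    (him : i < m) {x : Site (n + 3)} (hx : x ∈ layer lo hi i) :
    t0GaugeFn V lo hi τ x = hol V (lo 0) (chainWord lo i) * treeGaugeFn V (lo i) (hi i) τ x := by
  rw [hC.t0GaugeFn_eq V him hx, hol_t0word]

end Gauge

/-! ## §4 The gauge conditions: `V′ = 1` on the bonds of `T₀` -/

section TreeConditions

variable {lo hi : ℕ → Site (n + 3)} {τ : ℤ} {m : ℕ} {G : Type*} [Group G]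

/-- **p. 196: "We fix the gauge putting the bond variables equal to 1 for bonds belonging to the tree graph"**, for the whole
`T₀` of the chain: the bond variables of `V′` are `1` along every contour `Γ^i_{yⁱ,x}` of every layer (PART 3's
`BondsOneAlong`) and on the external bonds `⟨yⁱ⁺¹ − e₁, yⁱ⁺¹⟩` of the inner domains `Pⁱ⁺¹`, `i + 1 < m`.
[cite: Balaban1989LargeFieldI, p.196] -/
structure T0Gauge (V' : Site (n + 3) → Fin (n + 3) → G) (lo hi : ℕ → Site (n + 3)) (τ : ℤ) (m : ℕ) : Prop where
  tree : ∀ i, i < m → ∀ x ∈ layer lo hi i, BondsOneAlong V' (lo i) (contour (lo i) (hi i) τ x)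
  ext : ∀ i, i + 1 < m → V' (lo (i + 1) - e i0) i0 = 1

variable {V' V₀ : Site (n + 3) → Fin (n + 3) → G}

/-- The gauge conditions hold along the chain words `chainWord i`, `i < m`. [cite: Balaban1989LargeFieldI, p.196] -/
theorem T0Gauge.bondsOneAlong_chainWord (hT : T0Gauge V' lo hi τ m) (hC : ChainGeom lo hi τ m) :
    ∀ {i : ℕ}, i < m → BondsOneAlong V' (lo 0) (chainWord lo i)
  | 0, _ => bondsOneAlong_nil
  | i + 1, him => by
    have him' : i < m := by omega
    rw [chainWord_succ_eq hC him', bondsOneAlong_append, add_disp_chainWord, bondsOneAlong_append,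
      bondsOneAlong_cons, disp_contour, show lo i + (lo (i + 1) - e i0 - lo i) = lo (i + 1) - e i0 by abel, stepHol_true]
    exact ⟨hT.bondsOneAlong_chainWord hC him',
      hT.tree i him' _ (hC.extEnd_mem_layer (Nat.succ_le_of_lt him')), hT.ext i him, bondsOneAlong_nil⟩

/-- **The gauge conditions hold along every `T₀`-path.** [cite: Balaban1989LargeFieldI, p.196] -/
theorem T0Gauge.bondsOneAlong_t0word (hT : T0Gauge V' lo hi τ m) (hC : ChainGeom lo hi τ m) {i : ℕ} (him : i < m)
    {x : Site (n + 3)} (hx : x ∈ layer lo hi i) : BondsOneAlong V' (lo 0) (t0word lo hi τ i x) := by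
  rw [t0word, bondsOneAlong_append, add_disp_chainWord]
  exact ⟨hT.bondsOneAlong_chainWord hC him, hT.tree i him x hx⟩

/-- **[V] p. 381: "v is determined by V₀ only, because V′ satisfies the conditions"** — for the whole `T₀`: on `𝐁₀` the gauge
function built from `V″ = V′V₀` ((1.81)) is the one built from `V₀`. [cite: Balaban1989LargeFieldI, p.196] -/
theorem T0Gauge.t0GaugeFn_mulCfg (hT : T0Gauge V' lo hi τ m) (hC : ChainGeom lo hi τ m) {i : ℕ} (him : i < m)
    {x : Site (n + 3)} (hx : x ∈ layer lo hi i) : t0GaugeFn (mulCfg V' V₀) lo hi τ x = t0GaugeFn V₀ lo hi τ x := by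
  rw [hC.t0GaugeFn_eq _ him hx, hC.t0GaugeFn_eq _ him hx,
    hol_mulCfg_eq_of_bondsOneAlong (hT.bondsOneAlong_t0word hC him hx)]

end TreeConditions

/-! ## §5 Plaquette hypotheses restrict to subsets -/

/-- PART 1's localized plaquette hypothesis restricts to a smaller set of sites. [cite: Balaban1989LargeFieldII, p.381] -/
theorem _root_.Literature.MathematicalPhysics.QuantumFieldTheory.Balaban1983to89.B16Ineq382.PlaqSmallOn.mono {d : ℕ}
    {𝔸 : Type*} [NormedRing 𝔸] [NormOneClass 𝔸] {A A' : Set (Site d)} {V : Site d → Fin d → 𝔸ˣ} {ε : ℝ}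
    (h : B16Ineq382.PlaqSmallOn A V ε) (hA : A' ⊆ A) : B16Ineq382.PlaqSmallOn A' V ε :=
  fun z κ μ hκμ h1 h2 h3 h4 => h z κ μ hκμ (hA h1) (hA h2) (hA h3) (hA h4)

end Literature.MathematicalPhysics.QuantumFieldTheory.Balaban1983to89.B15TreeGauge196
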